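import Literature.NumberTheory.LFunctions.RealZeroSmoothedPerronShift
import Literature.NumberTheory.LFunctions.RealCharacterDivisorSums
import HarnessLib

/-!
# Bellotti–Puglisi's Lemma 1 at a COMPLEX point: the smoothed Perron integral for `ζ(s+w)L(s+w,χ)`
# shifted to `Re(s + w) = 0`, and the approximate formula
# `Σ_{n≤x} g(n) n^{−s} = ζ(s)L(s,χ) + O(x^{−σ}(|L(1,χ)| x A_s + √q log q (1+|t|)³ + Σ_{n≤x} g(n)))`
# on the whole half-strip `½ ≤ σ ≤ 1`

Topic `Literature/NumberTheory/LFunctions` (namespace `Literature.NumberTheory.LFunctions`, helpers in the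
sub-namespace `BPPerron`). PROOF LAYER (theorems only; no definition, no named fact, no new hypothesis):
the first of the tools towards the named facts `bellottiPuglisi2023_theorem1` / `_corollary1` of
`ElementaryDeuringHeilbronnPhenomenon.lean` (cell `parity-realchar`, SIEGEL INSTRUMENT, conditionals
column, the Deuring direction). Source: C. Bellotti, G. Puglisi, *Elementary methods in the study of the
Deuring–Heilbronn phenomenon*, Acta Arith. **208** (2023) 257–277 = arXiv:2201.03990v3, §2, Lemma 1
(p. 5) and the de-smoothing step of Lemma 2 (p. 6).

PRINT (p. 5, `g(n) = Σ_{d∣n} χ(d)`): "**Lemma 1.** Given `½ + ℓ ≤ σ ≤ 7/8` and `x ≫ q`, the relation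
`Σ_{n≤x} g(n) n^{−s} (1 − n/x)² = L(s,χ)ζ(s) + 2x^{1−s}L(1,χ)/((1−s)(2−s)(3−s)) +
O(|s| log²(2+|s|) exp{−½ log q/(log log q)^μ})` holds. *Proof.* Following exactly the proof of Lemma 2 of
[24] [Puglisi 1984], we obtain again that `½ Σ_{n≤x} g(n) n^{−s}(1 − n/x)² =
(1/2πi) ∫_{−σ−i∞}^{−σ+i∞} L(s+w,χ)ζ(s+w) x^w dw/(w(w+1)(w+2)) + L(s,χ)ζ(s)/2 +
x^{1−s}L(1,χ)/((1−s)(2−s)(3−s))`. Now, using […] the classical estimates […]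
`ζ(it) ≪ √(|t|+1) log(|t|+2)`, `L(it,χ) ≪ √(q(|t|+1)) log(q(|t|+1))`, we get
`|∫ x^{−σ+iu} √(q|t+u|) log q log²(|t+u|+2) du/((−σ+iu)(−σ+1+iu)(−σ+2+iu))| ≪ |s| q^{−ℓ} log q log²(2+|s|)`
[…]" and (p. 6, proof of Lemma 2) "`Σ_{n≤q} g(n)n^{−s}(1 − n/q)² = Σ_{n≤q} g(n)n^{−s} −
(2/q)Σ_{n≤q} g(n) n^{1−s} + (1/q²) Σ_{n≤q} g(n) n^{2−s}` […] `(1/q)|Σ_{n≤q} g(n) n^{1−s}| ≪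
q^{−½−ℓ} Σ_{n≤q} g(n)`".

HERE the Cesàro weight `(1 − u)²` is replaced by HOFFSTEIN's weight `P(u)/720`,
`P(u) = 1 − 15u² + 40u³ − 45u⁴ + 24u⁵ − 5u⁶ = (1−u)⁵(1+5u)` (tree `Hoffstein1980.hoffWeight`, Mellin
transform `K(w) = 1/(w(w+2)(w+3)(w+4)(w+5)(w+6))` = `hoffKernel`, smoothed Perron formula
`Hoffstein1980.integral_LSeries_mul_hoffKernel_eq`), exactly as the tree's real-point version
`GSPerron.gs_contour_identity` (`RealZeroSmoothedPerronShift.lean`, Goldfeld–Schinzel's (9) at a real zero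
`β`) — this changes only constants, and since `K` has no pole at `w = −1` the shifted line `Re w = −σ`
may be used for EVERY `½ ≤ σ ≤ 1` (the print stops at `σ ≤ 7/8` and treats `7/8 < σ < 1` separately):

* `BPPerron.contour_identity` — for `χ` primitive mod `q ≥ 3`, `½ ≤ Re s ≤ 1`, `s ≠ 1`, `x > 0`:
  `∫_{Re w = 2−σ} G − ∫_{Re w = −σ} G = 2π (L(1,χ) x^{1−s} K(1−s) + ζ(s)L(s,χ)/720)`,
  `G(w) = ζ(s+w)L(s+w,χ) x^w K(w)` (residue theorem `integral_vertical_sub_eq_sum_of_simplePoles`; poles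
  `w = 1 − s` of `ζ(s + w)` and `w = 0` of `K`);
* `BPPerron.exists_integral_line_le` — on `Re w = −σ`: `‖∫ G‖ ≤ C √q (2 log q + 1)(1 + |t|)³ x^{−σ}`
  with an ABSOLUTE `C` (the print's `|s| log²(2+|s|) q^{−ℓ} log q` at `x = q`; here from the tree's
  `GSPerron.norm_LFunction_imAxis_le` — Rademacher's convexity bound with `η = 1/(2 log q)` — and
  `GSPerron.exists_norm_riemannZeta_imAxis_le`; any polynomial in `|t|` serves the source, which then
  uses `|s| ≤ q^{ℓ/10}`);
* `BPPerron.perron_side` — `∫_{Re w = 2−σ} G = 2π Σ_{n≤x} g(n) n^{−s} P(n/x)/720` (tree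
  `integral_LSeries_mul_hoffKernel_eq` with `ζ·L(·,χ) = Σ (1∗χ)(n) n^{−z}`, `zetaL_eq_LSeries`);
* `BPPerron.norm_desmooth_le` — removing the weight: for quadratic `χ` (`g ≥ 0`) and `Re s ≤ 2`,
  `‖720 Σ_{n≤x} g(n)n^{−s}P(n/x)/720 − Σ_{n≤x} g(n) n^{−s}‖ ≤ 129 x^{−σ} Σ_{n≤x} g(n)`
  (`|P(u) − 1| ≤ 129u²` on `[0,1]` and `n^{2−σ} ≤ x^{2−σ}`);
* **`BPPerron.approx_formula`** — the assembled Lemma 1/Lemma 2 input, uniform and hypothesis-free: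
  there is an absolute `C` such that for every primitive quadratic `χ` mod `q ≥ 3`, every `s = σ + it`
  with `½ ≤ σ ≤ 1`, `s ≠ 1`, and every `x ≥ 1`,
  `‖Σ_{n≤x} g(n) n^{−s} − ζ(s)L(s,χ)‖ ≤
     720‖L(1,χ)‖ x^{1−σ} ‖K(1−s)‖ + C √q (2 log q + 1)(1+|t|)³ x^{−σ} + 129 x^{−σ} Σ_{n≤x} g(n)`,
  with `‖K(1 − s)‖ ≤ max(1, 1/|1−s|)/720` (`norm_hoffKernel_one_sub_le`). The class-number hypothesis of
  the source enters only later (through `L(1,χ) = πh/√q` and `Σ_{n≤q} g(n) ≪ h√q`), in the companion file.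

DECLARED DEVIATIONS from print: Hoffstein's kernel instead of `1/(w(w+1)(w+2))` (so no restriction
`σ ≤ 7/8`); Rademacher's `(q|1+it|)^{(1+η)/2}ζ(1+η)` and the tree's quadratic bound for `ζ(it)` in place
of the quoted "classical estimates" (exponent `(1+|t|)³` instead of `|s|log²`); all constants absolute.

LABEL (cell rule): instrument / proof layer (kernel). WHAT THIS IS NOT: nothing here assumes or produces a
zero of `ζ` or of `L(s,χ)`; nothing here bears on parity.

## References

* [BellottiPuglisi2023] C. Bellotti, G. Puglisi, Acta Arith. 208 (2023) 257–277 = arXiv:2201.03990v3,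
  §2 Lemma 1 p. 5, Lemma 2 p. 6.
* [Hoffstein1980SiegelTatuzawa] J. Hoffstein, Acta Arith. 38 (1980) 167–174, §2 (the kernel).
* [GoldfeldSchinzel1975] D. Goldfeld, A. Schinzel, Ann. SNS Pisa (4) 2 (1975), §2 (9) (the real-point
  version, tree `RealZeroSmoothedPerronShift.lean`).
* [Rademacher1959] H. Rademacher, Math. Z. 72 (1959) 192–204, Thm 3.
-/

noncomputable section

open Complex Set MeasureTheory Filter Topology DirichletCharacter
open scoped Real

namespace Literature.NumberTheory.LFunctions.BPPerron

open Literature.NumberTheory.LFunctions.Hoffstein1980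
open Literature.NumberTheory.LFunctions.Booker2006Turing Literature.Analysis.Complex
open Literature.NumberTheory.LFunctions.GSPerron

variable {q : ℕ} [NeZero q]

/-! ### Small helpers (copies of private lemmas of `RealZeroSmoothedPerronShift.lean`) -/

/-- Non-vanishing of the linear factors on `Re w > −j`. [folklore] -/
private lemma add_ne_zero_of_re {w : ℂ} {j : ℝ} (h : -j < w.re) : w + j ≠ 0 := by
  intro h'; have := congrArg Complex.re h'; simp at this; linarith

/-- `K` is holomorphic on `Re w > −2`, `w ≠ 0`. [folklore] -/
private lemma differentiableAt_hoffKernel {w : ℂ} (hw : -2 < w.re) (h0 : w ≠ 0) :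
    DifferentiableAt ℂ hoffKernel w := by
  unfold hoffKernel
  have h2 := add_ne_zero_of_re (w := w) (j := 2) (by linarith)
  have h3 := add_ne_zero_of_re (w := w) (j := 3) (by linarith)
  have h4 := add_ne_zero_of_re (w := w) (j := 4) (by linarith)
  have h5 := add_ne_zero_of_re (w := w) (j := 5) (by linarith)
  have h6 := add_ne_zero_of_re (w := w) (j := 6) (by linarith)
  push_cast at h2 h3 h4 h5 h6
  refine (differentiableAt_const _).div (by fun_prop) ?_
  exact mul_ne_zero (mul_ne_zero (mul_ne_zero (mul_ne_zero (mul_ne_zero h0 h2) h3) h4) h5) h6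

/-- `K = K₀/(w − 0)` with `K₀(s) = 1/((s+2)(s+3)(s+4)(s+5)(s+6))` (kept as an explicit expression:
this file is theorem-only). [folklore] -/
private lemma hoffKernel_eq_K0_div {w : ℂ} (h0 : w ≠ 0) :
    hoffKernel w = (1 / ((w + 2) * (w + 3) * (w + 4) * (w + 5) * (w + 6))) / (w - 0) := by
  unfold hoffKernel; rw [sub_zero]; field_simp

/-- `K₀` is holomorphic on `Re w > −2`. [folklore] -/
private lemma differentiableAt_hoffK0 {w : ℂ} (hw : -2 < w.re) :
    DifferentiableAt ℂ (fun w : ℂ ↦ 1 / ((w + 2) * (w + 3) * (w + 4) * (w + 5) * (w + 6))) w := by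
  have h2 := add_ne_zero_of_re (w := w) (j := 2) (by linarith)
  have h3 := add_ne_zero_of_re (w := w) (j := 3) (by linarith)
  have h4 := add_ne_zero_of_re (w := w) (j := 4) (by linarith)
  have h5 := add_ne_zero_of_re (w := w) (j := 5) (by linarith)
  have h6 := add_ne_zero_of_re (w := w) (j := 6) (by linarith)
  push_cast at h2 h3 h4 h5 h6
  refine (differentiableAt_const _).div (by fun_prop) ?_
  exact mul_ne_zero (mul_ne_zero (mul_ne_zero (mul_ne_zero h2 h3) h4) h5) h6

/-- `x^w` is entire for `x > 0`. [folklore] -/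
private lemma differentiable_cpow_const {x : ℝ} (hx : 0 < x) :
    Differentiable ℂ fun w : ℂ ↦ (x : ℂ) ^ w :=
  differentiable_id.const_cpow (Or.inl (ofReal_ne_zero.2 hx.ne'))

/-- A primitive character modulo `q > 1` is non-trivial. [folklore] -/
private lemma ne_one_of_isPrimitive (hq : 1 < q) {χ : DirichletCharacter ℂ q} (hχ : χ.IsPrimitive) :
    χ ≠ 1 := by
  rintro rfl
  have h : (1 : DirichletCharacter ℂ q).conductor = q := hχ
  rw [DirichletCharacter.conductor_one] at h; omega

/-- `‖K(w)‖ ≤ |Im w|^{-6}`. [folklore] -/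
private lemma norm_hoffKernel_le_of_im {w : ℂ} (hT : 0 < |w.im|) : ‖hoffKernel w‖ ≤ 1 / |w.im| ^ 6 := by
  have hj : ∀ j : ℝ, |w.im| ≤ ‖w + j‖ := fun j ↦ by
    have := abs_im_le_norm (w + j); simpa using this
  have h0 : |w.im| ≤ ‖w‖ := abs_im_le_norm w
  unfold hoffKernel
  rw [norm_div, norm_one]
  simp only [norm_mul]
  have h2 := hj 2; have h3 := hj 3; have h4 := hj 4; have h5 := hj 5; have h6 := hj 6
  push_cast at h2 h3 h4 h5 h6
  have hprod : |w.im| ^ 6 ≤ ‖w‖ * ‖w + 2‖ * ‖w + 3‖ * ‖w + 4‖ * ‖w + 5‖ * ‖w + 6‖ := by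
    calc |w.im| ^ 6 = |w.im| * |w.im| * |w.im| * |w.im| * |w.im| * |w.im| := by ring
      _ ≤ _ := by gcongr
  exact one_div_le_one_div_of_le (by positivity) hprod

/-- `x^σ ≤ x^a + x^b` for `σ ∈ [a, b]`, `x > 0`. [folklore] -/
private lemma rpow_le_add_of_mem {x a b σ : ℝ} (hx : 0 < x) (h1 : a ≤ σ) (h2 : σ ≤ b) :
    x ^ σ ≤ x ^ a + x ^ b := by
  have hxa : 0 < x ^ a := Real.rpow_pos_of_pos hx a
  have hxb : 0 < x ^ b := Real.rpow_pos_of_pos hx b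
  rcases le_or_gt 1 x with hx1 | hx1
  · have := Real.rpow_le_rpow_of_exponent_le hx1 h2; linarith
  · have := Real.rpow_le_rpow_of_exponent_ge hx hx1.le h1; linarith

/-! ### The kernel on the line `Re w = −σ` and at the pole `w = 1 − s` -/

/-- On `Re w = −σ`, `½ ≤ σ ≤ 1`: `‖K(−σ + iy)‖ ≤ 128/(1 + |y|)⁶` (the factors have modulus
`≥ (1 + |y|)/4` resp. `≥ (1 + |y|)/2`). [folklore] -/
private theorem norm_hoffKernel_line_le {σ : ℝ} (hσ0 : 1 / 2 ≤ σ) (hσ1 : σ ≤ 1) (y : ℝ) :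
    ‖hoffKernel ((-σ : ℝ) + y * I)‖ ≤ 128 / (1 + |y|) ^ 6 := by
  set w : ℂ := ((-σ : ℝ) : ℂ) + y * I with hw
  -- `‖w + j‖² = (j − σ)² + y²`
  have hnj : ∀ j : ℝ, ‖w + j‖ ^ 2 = (j - σ) ^ 2 + y ^ 2 := fun j ↦ by
    rw [Complex.sq_norm, Complex.normSq_apply]
    simp [hw]; ring
  have hy0 : 0 ≤ |y| := abs_nonneg y
  have hy2 : |y| ^ 2 = y ^ 2 := sq_abs y
  have hsq : ∀ {u v : ℝ}, 0 ≤ u → 0 ≤ v → u ^ 2 ≤ v ^ 2 → u ≤ v := fun hu hv h ↦ by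
    nlinarith
  have hσsq : 1 / 4 ≤ σ ^ 2 := by nlinarith
  have hA : (1 + |y|) / 4 ≤ ‖w‖ := by
    refine hsq (by positivity) (norm_nonneg _) ?_
    have := hnj 0
    simp only [ofReal_zero, add_zero] at this
    rw [this, ← hy2, zero_sub, neg_sq]
    nlinarith [sq_nonneg (|y| - 1)]
  have hB : ∀ j : ℝ, 2 ≤ j → (1 + |y|) / 2 ≤ ‖w + j‖ := fun j hj ↦ by
    refine hsq (by positivity) (norm_nonneg _) ?_
    have h1 : 1 ≤ (j - σ) ^ 2 := by nlinarith
    rw [hnj j, ← hy2]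
    nlinarith [sq_nonneg (|y| - 1)]
  have h2 := hB 2 (by norm_num); have h3 := hB 3 (by norm_num); have h4 := hB 4 (by norm_num)
  have h5 := hB 5 (by norm_num); have h6 := hB 6 (by norm_num)
  push_cast at h2 h3 h4 h5 h6
  unfold hoffKernel
  rw [norm_div, norm_one]
  simp only [norm_mul]
  have hprod : (1 + |y|) ^ 6 / 128 ≤ ‖w‖ * ‖w + 2‖ * ‖w + 3‖ * ‖w + 4‖ * ‖w + 5‖ * ‖w + 6‖ := by
    calc (1 + |y|) ^ 6 / 128 = (1 + |y|) / 4 * ((1 + |y|) / 2) * ((1 + |y|) / 2) *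
        ((1 + |y|) / 2) * ((1 + |y|) / 2) * ((1 + |y|) / 2) := by ring
      _ ≤ _ := by gcongr
  have hpos : 0 < (1 + |y|) ^ 6 / 128 := by positivity
  calc 1 / (‖w‖ * ‖w + 2‖ * ‖w + 3‖ * ‖w + 4‖ * ‖w + 5‖ * ‖w + 6‖)
      ≤ 1 / ((1 + |y|) ^ 6 / 128) := one_div_le_one_div_of_le hpos hprod
    _ = 128 / (1 + |y|) ^ 6 := by rw [one_div_div]

/-- **The kernel at the pole `w = 1 − s`**: for `Re s ≤ 1`, `s ≠ 1`,
`‖K(1 − s)‖ ≤ max(1, 1/|1 − s|)/720` (`|j + 1 − s| ≥ j` for `j = 2, …, 6`). This is the factor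
`A_s = max(1, 1/|1 − s|)` of Pintz's Lemma 4 (part III, p. 298); on Bellotti–Puglisi's `H(ℓ, q)` it is
`≤ log⁴q`. [cite: BellottiPuglisi2023, §2 Lemma 1 p. 5] -/
theorem norm_hoffKernel_one_sub_le {s : ℂ} (hσ1 : s.re ≤ 1) (hs1 : s ≠ 1) :
    ‖hoffKernel (1 - s)‖ ≤ max 1 (1 / ‖1 - s‖) / 720 := by
  set w : ℂ := 1 - s with hw
  have hw0 : w ≠ 0 := sub_ne_zero.2 (Ne.symm hs1)
  have hwre : 0 ≤ w.re := by simp [hw]; linarith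
  have hn0 : 0 < ‖w‖ := norm_pos_iff.2 hw0
  -- `‖w + j‖ ≥ j`
  have hj : ∀ j : ℝ, 0 ≤ j → j ≤ ‖w + j‖ := fun j hj0 ↦ by
    calc j ≤ (w + j).re := by simp; linarith
      _ ≤ ‖w + j‖ := re_le_norm _
  have h2 := hj 2 (by norm_num); have h3 := hj 3 (by norm_num); have h4 := hj 4 (by norm_num)
  have h5 := hj 5 (by norm_num); have h6 := hj 6 (by norm_num)
  push_cast at h2 h3 h4 h5 h6
  unfold hoffKernel
  rw [norm_div, norm_one]
  simp only [norm_mul]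
  have hprod : ‖w‖ * 720 ≤ ‖w‖ * ‖w + 2‖ * ‖w + 3‖ * ‖w + 4‖ * ‖w + 5‖ * ‖w + 6‖ := by
    calc ‖w‖ * 720 = ‖w‖ * 2 * 3 * 4 * 5 * 6 := by ring
      _ ≤ _ := by gcongr
  have hpos : 0 < ‖w‖ * 720 := by positivity
  calc 1 / (‖w‖ * ‖w + 2‖ * ‖w + 3‖ * ‖w + 4‖ * ‖w + 5‖ * ‖w + 6‖)
      ≤ 1 / (‖w‖ * 720) := one_div_le_one_div_of_le hpos hprod
    _ = (1 / ‖w‖) / 720 := by rw [div_div]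
    _ ≤ max 1 (1 / ‖w‖) / 720 := by gcongr; exact le_max_right _ _

/-! ### The integrand on the line `Re w = −σ` (Lemma 1's estimate) -/

/-- The point `s + (−σ + iy)` on the shifted line is `i(t + y)`. [folklore] -/
private lemma add_line_eq (s : ℂ) (y : ℝ) :
    s + (((-s.re : ℝ) : ℂ) + y * I) = ((s.im + y : ℝ) : ℂ) * I := by
  apply Complex.ext <;> simp

/-- **The shifted line, pointwise**: there is an absolute `C` with
`‖G(−σ + iy)‖ ≤ C √q (2 log q + 1)(1 + |t|)³ x^{−σ} (1 + y²)⁻¹` for every primitive `χ` mod `q ≥ 3`,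
`s = σ + it` with `½ ≤ σ ≤ 1`, `x > 0` (`G(w) = ζ(s+w) L(s+w,χ) x^w K(w)`): the two "classical
estimates" on `Re = 0` (here `GSPerron.exists_norm_riemannZeta_imAxis_le`,
`GSPerron.norm_LFunction_imAxis_le`) against the kernel's `|w|^{−6}`.
[cite: BellottiPuglisi2023, §2 proof of Lemma 1 p. 5] -/
theorem exists_line_bound :
    ∃ C : ℝ, 0 < C ∧ ∀ {q : ℕ} [NeZero q], 3 ≤ q → ∀ {χ : DirichletCharacter ℂ q}, χ.IsPrimitive →
      ∀ {s : ℂ}, 1 / 2 ≤ s.re → s.re ≤ 1 → ∀ {x : ℝ}, 0 < x → ∀ y : ℝ,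
        ‖zetaL χ (s + (((-s.re : ℝ) : ℂ) + y * I)) * (x : ℂ) ^ (((-s.re : ℝ) : ℂ) + y * I) *
            hoffKernel (((-s.re : ℝ) : ℂ) + y * I)‖ ≤
          C * (Real.sqrt q * (2 * Real.log q + 1)) * (1 + |s.im|) ^ 3 * x ^ (-s.re) *
            (1 + y ^ 2)⁻¹ := by
  obtain ⟨C₁, hC₁, hζ⟩ := exists_norm_riemannZeta_imAxis_le
  refine ⟨128 * Real.exp (1 / 4) * C₁, by positivity, ?_⟩
  intro q _ hq χ hχ s hσ0 hσ1 x hx y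
  rw [add_line_eq s y]
  set σ : ℝ := s.re with hσ
  set t : ℝ := s.im with ht
  set w : ℂ := ((-σ : ℝ) : ℂ) + y * I with hw
  have hwre : w.re = -σ := by simp [hw]
  set u : ℝ := t + y with hu
  have hZ := hζ u
  have hL := norm_LFunction_imAxis_le hq hχ u
  have hK := norm_hoffKernel_line_le hσ0 hσ1 y
  have hxw : ‖(x : ℂ) ^ w‖ = x ^ (-σ) := by rw [norm_cpow_eq_rpow_re_of_pos hx, hwre]
  have hy0 : 0 ≤ |y| := abs_nonneg y
  have ht0 : 0 ≤ |t| := abs_nonneg t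
  have hxσ : 0 < x ^ (-σ) := Real.rpow_pos_of_pos hx _
  have hsq : 0 < Real.sqrt q * (2 * Real.log q + 1) := by
    have : (3 : ℝ) ≤ q := by exact_mod_cast hq
    have hl : 0 ≤ Real.log q := Real.log_nonneg (by linarith)
    have : 0 < Real.sqrt q := Real.sqrt_pos.mpr (by linarith)
    positivity
  rw [norm_mul, norm_mul, zetaL, norm_mul, hxw]
  -- `(1+u²)(1+|u|) ≤ (1+|u|)³ ≤ (1+|t|)³ (1+|y|)³`
  have hu1 : 1 + u ^ 2 ≤ (1 + |u|) ^ 2 := by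
    rw [← sq_abs u]; nlinarith [abs_nonneg u]
  have hu2 : 1 + |u| ≤ (1 + |t|) * (1 + |y|) := by
    have : |u| ≤ |t| + |y| := by rw [hu]; exact abs_add_le t y
    nlinarith
  have hu3 : (1 + u ^ 2) * (1 + |u|) ≤ (1 + |t|) ^ 3 * (1 + |y|) ^ 3 := by
    calc (1 + u ^ 2) * (1 + |u|) ≤ (1 + |u|) ^ 2 * (1 + |u|) :=
          mul_le_mul_of_nonneg_right hu1 (by positivity)
      _ = (1 + |u|) ^ 3 := by ring
      _ ≤ ((1 + |t|) * (1 + |y|)) ^ 3 := pow_le_pow_left₀ (by positivity) hu2 3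
      _ = (1 + |t|) ^ 3 * (1 + |y|) ^ 3 := by ring
  -- `(1+|y|)³ · 128/(1+|y|)⁶ ≤ 128 (1+y²)⁻¹`
  have hpoly : (1 + |y|) ^ 3 * (128 / (1 + |y|) ^ 6) ≤ 128 * (1 + y ^ 2)⁻¹ := by
    have h1y : 0 < 1 + |y| := by positivity
    have h1y2 : 0 < 1 + y ^ 2 := by positivity
    rw [show (1 + |y|) ^ 3 * (128 / (1 + |y|) ^ 6) = 128 * (1 / (1 + |y|) ^ 3) by
      field_simp]
    refine mul_le_mul_of_nonneg_left ?_ (by norm_num)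
    rw [inv_eq_one_div]
    refine one_div_le_one_div_of_le h1y2 ?_
    have ha : 1 + y ^ 2 ≤ (1 + |y|) ^ 2 := by rw [← sq_abs y]; nlinarith
    calc 1 + y ^ 2 ≤ (1 + |y|) ^ 2 := ha
      _ ≤ (1 + |y|) ^ 3 := pow_le_pow_right₀ (by linarith) (by norm_num)
  calc ‖riemannZeta (↑u * I)‖ * ‖χ.LFunction (↑u * I)‖ * x ^ (-σ) * ‖hoffKernel w‖
      ≤ (C₁ * (1 + u ^ 2)) * (Real.exp (1 / 4) * Real.sqrt q * (2 * Real.log q + 1) * (1 + |u|)) *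
          x ^ (-σ) * (128 / (1 + |y|) ^ 6) := by
        gcongr
    _ = Real.exp (1 / 4) * C₁ * (Real.sqrt q * (2 * Real.log q + 1)) * x ^ (-σ) *
          (((1 + u ^ 2) * (1 + |u|)) * (128 / (1 + |y|) ^ 6)) := by ring
    _ ≤ Real.exp (1 / 4) * C₁ * (Real.sqrt q * (2 * Real.log q + 1)) * x ^ (-σ) *
          (((1 + |t|) ^ 3 * (1 + |y|) ^ 3) * (128 / (1 + |y|) ^ 6)) := by gcongr
    _ = Real.exp (1 / 4) * C₁ * (Real.sqrt q * (2 * Real.log q + 1)) * x ^ (-σ) * (1 + |t|) ^ 3 *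
          ((1 + |y|) ^ 3 * (128 / (1 + |y|) ^ 6)) := by ring
    _ ≤ Real.exp (1 / 4) * C₁ * (Real.sqrt q * (2 * Real.log q + 1)) * x ^ (-σ) * (1 + |t|) ^ 3 *
          (128 * (1 + y ^ 2)⁻¹) := by gcongr
    _ = 128 * Real.exp (1 / 4) * C₁ * (Real.sqrt q * (2 * Real.log q + 1)) * (1 + |t|) ^ 3 *
          x ^ (-σ) * (1 + y ^ 2)⁻¹ := by ring

/-- The integrand `G(w) = ζ(s+w)L(s+w,χ) x^w K(w)` is continuous along every vertical line `Re w = c`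
with `c + Re s ≠ 1`, `c > −2`, `c ≠ 0`. [folklore] -/
private lemma continuous_line {χ : DirichletCharacter ℂ q} (hχ1 : χ ≠ 1) {s : ℂ} {x c : ℝ}
    (hx : 0 < x) (hc1 : c + s.re ≠ 1) (hc2 : -2 < c) (hc0 : c ≠ 0) :
    Continuous fun y : ℝ ↦ zetaL χ (s + ((c : ℂ) + y * I)) * (x : ℂ) ^ ((c : ℂ) + y * I) *
      hoffKernel ((c : ℂ) + y * I) := by
  refine continuous_iff_continuousAt.2 fun y ↦ ?_
  have hl : Continuous fun y : ℝ ↦ (c : ℂ) + y * I := by fun_prop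
  have hwre : ((c : ℂ) + y * I).re = c := by simp
  have hne1 : s + ((c : ℂ) + y * I) ≠ 1 := fun h ↦ hc1 (by
    have := congrArg Complex.re h; simp at this; linarith)
  have hne0 : (c : ℂ) + y * I ≠ 0 := fun h ↦ hc0 (by
    have := congrArg Complex.re h; simpa using this)
  have hd : DifferentiableAt ℂ (fun w : ℂ ↦ zetaL χ (s + w) * (x : ℂ) ^ w * hoffKernel w)
      ((c : ℂ) + y * I) := by
    have hlin : DifferentiableAt ℂ (fun w : ℂ ↦ s + w) ((c : ℂ) + y * I) :=
      (differentiableAt_const _).add differentiableAt_id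
    have hz : DifferentiableAt ℂ (zetaL χ ∘ fun w : ℂ ↦ s + w) ((c : ℂ) + y * I) :=
      (differentiableAt_zetaL (s := s + ((c : ℂ) + y * I)) hχ1 hne1).comp ((c : ℂ) + y * I) hlin
    exact (hz.mul (differentiable_cpow_const hx _)).mul
      (differentiableAt_hoffKernel (by rw [hwre]; exact hc2) hne0)
  exact ContinuousAt.comp (g := fun w : ℂ ↦ zetaL χ (s + w) * (x : ℂ) ^ w * hoffKernel w)
    (f := fun y : ℝ ↦ (c : ℂ) + y * I) hd.continuousAt hl.continuousAt

/-- **The shifted line is absolutely integrable.** [cite: BellottiPuglisi2023, §2 proof of Lemma 1 p. 5] -/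
theorem integrable_line (hq : 3 ≤ q) {χ : DirichletCharacter ℂ q} (hχ : χ.IsPrimitive)
    {s : ℂ} (hσ0 : 1 / 2 ≤ s.re) (hσ1 : s.re ≤ 1) {x : ℝ} (hx : 0 < x) :
    Integrable fun y : ℝ ↦ zetaL χ (s + (((-s.re : ℝ) : ℂ) + y * I)) *
      (x : ℂ) ^ (((-s.re : ℝ) : ℂ) + y * I) * hoffKernel (((-s.re : ℝ) : ℂ) + y * I) := by
  obtain ⟨C, _, hb⟩ := exists_line_bound
  have hχ1 := ne_one_of_isPrimitive (by omega) hχ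
  refine ((integrable_inv_one_add_sq.const_mul
    (C * (Real.sqrt q * (2 * Real.log q + 1)) * (1 + |s.im|) ^ 3 * x ^ (-s.re)))).mono' ?_
    (Eventually.of_forall fun y ↦ hb hq hχ hσ0 hσ1 hx y)
  exact (continuous_line hχ1 hx (by linarith) (by linarith) (by linarith)).aestronglyMeasurable

/-- **The error term of Lemma 1**: there is an absolute `C` with
`‖∫_{Re w = −σ} G‖ ≤ C √q (2 log q + 1)(1 + |t|)³ x^{−σ}` for every primitive `χ` mod `q ≥ 3`,
`½ ≤ σ ≤ 1`, `x > 0` — the source's `O(|s| log²(2+|s|) · x^{−σ}√q log q)`-type bound.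
[cite: BellottiPuglisi2023, §2 proof of Lemma 1 p. 5] -/
theorem exists_integral_line_le :
    ∃ C : ℝ, 0 < C ∧ ∀ {q : ℕ} [NeZero q], 3 ≤ q → ∀ {χ : DirichletCharacter ℂ q}, χ.IsPrimitive →
      ∀ {s : ℂ}, 1 / 2 ≤ s.re → s.re ≤ 1 → ∀ {x : ℝ}, 0 < x →
        ‖∫ y : ℝ, zetaL χ (s + (((-s.re : ℝ) : ℂ) + y * I)) * (x : ℂ) ^ (((-s.re : ℝ) : ℂ) + y * I) *
            hoffKernel (((-s.re : ℝ) : ℂ) + y * I)‖ ≤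
          C * (Real.sqrt q * (2 * Real.log q + 1)) * (1 + |s.im|) ^ 3 * x ^ (-s.re) := by
  obtain ⟨C, hC, hb⟩ := exists_line_bound
  refine ⟨C * π, by positivity, ?_⟩
  intro q _ hq χ hχ s hσ0 hσ1 x hx
  set M : ℝ := C * (Real.sqrt q * (2 * Real.log q + 1)) * (1 + |s.im|) ^ 3 * x ^ (-s.re) with hM
  have hmaj : ∀ y : ℝ, ‖zetaL χ (s + (((-s.re : ℝ) : ℂ) + y * I)) *
      (x : ℂ) ^ (((-s.re : ℝ) : ℂ) + y * I) * hoffKernel (((-s.re : ℝ) : ℂ) + y * I)‖ ≤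
      M * (1 + y ^ 2)⁻¹ := fun y ↦ hb hq hχ hσ0 hσ1 hx y
  calc ‖∫ y : ℝ, zetaL χ (s + (((-s.re : ℝ) : ℂ) + y * I)) * (x : ℂ) ^ (((-s.re : ℝ) : ℂ) + y * I) *
          hoffKernel (((-s.re : ℝ) : ℂ) + y * I)‖
      ≤ ∫ y : ℝ, ‖zetaL χ (s + (((-s.re : ℝ) : ℂ) + y * I)) * (x : ℂ) ^ (((-s.re : ℝ) : ℂ) + y * I) *
          hoffKernel (((-s.re : ℝ) : ℂ) + y * I)‖ := norm_integral_le_integral_norm _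
    _ ≤ ∫ y : ℝ, M * (1 + y ^ 2)⁻¹ :=
        integral_mono_of_nonneg (Eventually.of_forall fun y ↦ norm_nonneg _)
          (integrable_inv_one_add_sq.const_mul _) (Eventually.of_forall hmaj)
    _ = M * π := by rw [integral_const_mul, integral_univ_inv_one_add_sq]
    _ = C * π * (Real.sqrt q * (2 * Real.log q + 1)) * (1 + |s.im|) ^ 3 * x ^ (-s.re) := by
        rw [hM]; ring

/-! ### The contour shift to `Re(s + w) = 0` (the display of p. 5) -/

/-- **Bellotti–Puglisi's Lemma 1 display, for Hoffstein's kernel, at a complex point.** For a primitive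
`χ` modulo `q ≥ 3`, `s` with `½ ≤ Re s ≤ 1`, `s ≠ 1`, and `x > 0`:
`∫_{Re w = 2−σ} G − ∫_{Re w = −σ} G = 2π (L(1,χ) x^{1−s} K(1−s) + F(s)/720)`,
`G(w) = F(s+w) x^w K(w)`, `F = ζ · L(·, χ)` — the residues at the pole `w = 1 − s` of `ζ(s + w)` and
at the pole `w = 0` of the kernel ("`(1/2πi)∫_{(−σ)} L(s+w,χ)ζ(s+w) x^w dw/(w(w+1)(w+2)) +
L(s,χ)ζ(s)/2 + x^{1−s}L(1,χ)/((1−s)(2−s)(3−s))`", p. 5).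
[cite: BellottiPuglisi2023, §2 proof of Lemma 1 p. 5]
[cite: Hoffstein1980SiegelTatuzawa, §2 proof of Lemma 1 (3) p. 169] -/
theorem contour_identity (hq : 3 ≤ q) {χ : DirichletCharacter ℂ q} (hχ : χ.IsPrimitive)
    {s : ℂ} (hσ0 : 1 / 2 ≤ s.re) (hσ1 : s.re ≤ 1) (hs1 : s ≠ 1) {x : ℝ} (hx : 0 < x) :
    (∫ y : ℝ, zetaL χ (s + (((2 - s.re : ℝ) : ℂ) + y * I)) * (x : ℂ) ^ (((2 - s.re : ℝ) : ℂ) + y * I) *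
        hoffKernel (((2 - s.re : ℝ) : ℂ) + y * I)) -
      ∫ y : ℝ, zetaL χ (s + (((-s.re : ℝ) : ℂ) + y * I)) * (x : ℂ) ^ (((-s.re : ℝ) : ℂ) + y * I) *
        hoffKernel (((-s.re : ℝ) : ℂ) + y * I) =
      2 * π * (χ.LFunction 1 * (x : ℂ) ^ (1 - s) * hoffKernel (1 - s) + zetaL χ s / 720) := by
  have hq1 : 1 < q := by omega
  have hχ1 : χ ≠ 1 := ne_one_of_isPrimitive hq1 hχ
  set σ : ℝ := s.re with hσ
  set a : ℝ := -σ with ha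
  set b : ℝ := 2 - σ with hb
  have hab : a < b := by rw [ha, hb]; linarith
  set p₁ : ℂ := 1 - s with hp₁
  set F : ℂ → ℂ := fun w ↦ zetaL χ (s + w) * (x : ℂ) ^ w * hoffKernel w with hFdef
  classical
  set S : Finset ℂ := {p₁, 0} with hS
  set r : ℂ → ℂ := fun p ↦ if p = p₁ then χ.LFunction 1 * (x : ℂ) ^ p₁ * hoffKernel p₁
    else zetaL χ s / 720 with hr
  have hp₁re : p₁.re = 1 - σ := by simp [hp₁, hσ]
  have hp₁0 : p₁ ≠ 0 := sub_ne_zero.2 (Ne.symm hs1)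
  have hsum : ∑ p ∈ S, r p = χ.LFunction 1 * (x : ℂ) ^ p₁ * hoffKernel p₁ + zetaL χ s / 720 := by
    rw [hS, Finset.sum_insert (by simp [hp₁0]), Finset.sum_singleton]
    simp only [hr, if_neg hp₁0.symm, if_true]
  set U : Set ℂ := {w : ℂ | -2 < w.re} with hU
  have hUo : IsOpen U := isOpen_lt continuous_const Complex.continuous_re
  have hxw := differentiable_cpow_const hx
  have hmemS : ∀ p : ℂ, p ∈ S ↔ p = p₁ ∨ p = 0 := fun p ↦ by
    rw [hS, Finset.mem_insert, Finset.mem_singleton]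
  -- `s + w = 1 ↔ w = p₁`
  have hsw1 : ∀ w : ℂ, s + w = 1 ↔ w = p₁ := fun w ↦ by
    rw [hp₁]; constructor <;> intro h <;> linear_combination h
  -- growth constant for the decay
  obtain ⟨C, hC, hgrowth⟩ := exists_norm_zetaL_le_pow hq1 hχ
  have key := integral_vertical_sub_eq_sum_of_simplePoles (F := F) hab S r U hUo
    (fun w hw ↦ by
      simp only [mem_preimage, mem_Icc] at hw; show -2 < w.re; rw [ha] at hw; linarith)
    (fun p hp ↦ by
      rcases (hmemS p).1 hp with rfl | rfl
      · rw [hp₁re, ha, hb]; constructor <;> linarith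
      · rw [ha, hb]; simp; constructor <;> linarith)
    ?hF ?hpole ?hia ?hib ?hdecay
  · rw [hsum] at key
    simpa only [hFdef] using key
  -- (hF) holomorphy off the poles
  · intro w hw
    rcases hw with ⟨hwU, hwS⟩
    have hwU' : -2 < w.re := hwU
    have hwS' : ¬ (w = p₁ ∨ w = 0) := fun h ↦ hwS ((hmemS w).2 h)
    push Not at hwS'
    obtain ⟨hw1, hw0⟩ := hwS'
    have hws : s + w ≠ 1 := fun h ↦ hw1 ((hsw1 w).1 h)
    refine DifferentiableAt.differentiableWithinAt ?_
    have hlin : DifferentiableAt ℂ (fun w : ℂ ↦ s + w) w :=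
      (differentiableAt_const _).add differentiableAt_id
    have hz : DifferentiableAt ℂ (zetaL χ ∘ fun w : ℂ ↦ s + w) w :=
      (differentiableAt_zetaL (s := s + w) hχ1 hws).comp w hlin
    exact (hz.mul (hxw w)).mul (differentiableAt_hoffKernel hwU' hw0)
  -- (hpole) the two simple poles
  · intro p hp
    rcases (hmemS p).1 hp with rfl | rfl
    · -- `w = 1 − s`: pole of `ζ(s + w)`
      set V : Set ℂ := {w : ℂ | w ≠ 0 ∧ -2 < w.re} with hV
      refine ⟨fun w ↦ zetaReg1 (s + w) * χ.LFunction (s + w) * (x : ℂ) ^ w * hoffKernel w, V,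
        ?_, ?_, ?_, ?_⟩
      · exact (isOpen_ne.inter (isOpen_lt continuous_const Complex.continuous_re)).mem_nhds
          ⟨hp₁0, by show -2 < p₁.re; rw [hp₁re]; linarith⟩
      · intro w hw
        rcases hw with ⟨hw0, hw2⟩
        refine DifferentiableAt.differentiableWithinAt ?_
        have hlin : DifferentiableAt ℂ (fun w : ℂ ↦ s + w) w :=
          (differentiableAt_const _).add differentiableAt_id
        have hz : DifferentiableAt ℂ (fun w : ℂ ↦ zetaReg1 (s + w)) w :=
          (differentiable_zetaReg1 _).comp w hlin
        have hL : DifferentiableAt ℂ (fun w : ℂ ↦ χ.LFunction (s + w)) w :=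
          (differentiable_LFunction hχ1 _).comp w hlin
        exact ((hz.mul hL).mul (hxw w)).mul (differentiableAt_hoffKernel hw2 hw0)
      · simp only [hr, if_pos rfl]
        rw [show s + p₁ = 1 by rw [hp₁]; ring, zetaReg1_mul_LFunction_one]
      · intro w _ hwp
        have hws : s + w ≠ 1 := fun h ↦ hwp ((hsw1 w).1 h)
        simp only [hFdef]
        rw [zetaL_eq_div_of_ne_one χ hws, show s + w - 1 = w - p₁ by rw [hp₁]; ring]
        field_simp
    · -- `w = 0`: pole of the kernel
      set V : Set ℂ := {w : ℂ | w ≠ p₁ ∧ -2 < w.re} with hV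
      refine ⟨fun w ↦ zetaL χ (s + w) * (x : ℂ) ^ w *
        (1 / ((w + 2) * (w + 3) * (w + 4) * (w + 5) * (w + 6))), V, ?_, ?_, ?_, ?_⟩
      · exact (isOpen_ne.inter (isOpen_lt continuous_const Complex.continuous_re)).mem_nhds
          ⟨hp₁0.symm, by show -2 < (0:ℂ).re; simp⟩
      · intro w hw
        rcases hw with ⟨hw1, hw2⟩
        have hws : s + w ≠ 1 := fun h ↦ hw1 ((hsw1 w).1 h)
        refine DifferentiableAt.differentiableWithinAt ?_
        have hlin : DifferentiableAt ℂ (fun w : ℂ ↦ s + w) w :=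
          (differentiableAt_const _).add differentiableAt_id
        have hz : DifferentiableAt ℂ (zetaL χ ∘ fun w : ℂ ↦ s + w) w :=
          (differentiableAt_zetaL (s := s + w) hχ1 hws).comp w hlin
        exact (hz.mul (hxw w)).mul (differentiableAt_hoffK0 hw2)
      · simp only [hr, if_neg hp₁0.symm]
        rw [add_zero, cpow_zero, mul_one]
        ring
      · intro w _ hw0
        simp only [hFdef]
        rw [hoffKernel_eq_K0_div hw0]
        field_simp
  -- (hia) integrability on the left line
  · exact integrable_line hq hχ hσ0 hσ1 hx
  -- (hib) integrability on the right line
  · have hb0 : 0 < b := by rw [hb]; linarith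
    have hK := integrable_hoffKernel_vertical hb0
    have hcont : Continuous fun y : ℝ ↦ zetaL χ (s + (↑b + y * I)) * (x : ℂ) ^ ((b : ℂ) + y * I) := by
      refine Continuous.mul ?_ ((differentiable_cpow_const hx).continuous.comp (by fun_prop))
      refine continuous_iff_continuousAt.2 fun y ↦ ?_
      have hne : s + ((b : ℂ) + y * I) ≠ 1 := by
        intro h
        have h' := congrArg Complex.re h
        simp only [add_re, ofReal_re, mul_re, I_re, I_im, ofReal_im, mul_zero, zero_mul, sub_zero,
          one_re] at h'
        rw [hb] at h'; linarith
      exact ContinuousAt.comp (g := zetaL χ) (f := fun y : ℝ ↦ s + ((b : ℂ) + y * I))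
        (differentiableAt_zetaL hχ1 hne).continuousAt
        (by fun_prop : Continuous fun y : ℝ ↦ s + ((b : ℂ) + y * I)).continuousAt
    have hZ2 : 0 ≤ bigZ 2 := (bigZ_pos (by norm_num)).le
    have hint := hK.bdd_mul hcont.aestronglyMeasurable (c := bigZ 2 * bigZ 2 * x ^ b)
      (Eventually.of_forall fun y ↦ by
        rw [norm_mul, norm_cpow_eq_rpow_re_of_pos hx]
        have hre : ((b : ℂ) + y * I).re = b := by simp
        rw [hre]
        have e : s + ((b : ℂ) + y * I) = ((2 : ℝ) : ℂ) + ↑(s.im + y) * I := by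
          apply Complex.ext <;> simp [hb, hσ]
        rw [e, zetaL, norm_mul]
        have h1 := norm_riemannZeta_le_bigZ (σ := 2) (by norm_num) (s.im + y)
        have h2 := norm_LFunction_le_bigZ χ (σ := 2) (by norm_num) (s.im + y)
        have hxb : 0 ≤ x ^ b := (Real.rpow_pos_of_pos hx b).le
        calc ‖riemannZeta (↑(2:ℝ) + ↑(s.im + y) * I)‖ * ‖χ.LFunction (↑(2:ℝ) + ↑(s.im + y) * I)‖ * x ^ b
            ≤ bigZ 2 * bigZ 2 * x ^ b := by gcongr)
    simpa [hFdef, mul_assoc] using hint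
  -- (hdecay) the horizontal sides
  · intro ε hε
    set M : ℝ := x ^ a + x ^ b with hM
    have hM0 : 0 < M := by
      rw [hM]; exact add_pos (Real.rpow_pos_of_pos hx a) (Real.rpow_pos_of_pos hx b)
    refine ⟨max (2 + |s.im|) (max 1 (C * (1 + |s.im|) ^ 4 * M / ε)), fun T hT τ hτ ↦ ?_⟩
    have hT2 : 2 + |s.im| ≤ |T| := (le_max_left _ _).trans hT
    have hT1' : 1 ≤ |T| := (le_max_left _ _).trans ((le_max_right _ _).trans hT)
    have hT1 : C * (1 + |s.im|) ^ 4 * M / ε ≤ |T| :=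
      (le_max_right _ _).trans ((le_max_right _ _).trans hT)
    have hTpos : 0 < |T| := by linarith [abs_nonneg s.im]
    set w : ℂ := (τ : ℂ) + T * I with hw
    have hwre : w.re = τ := by simp [hw]
    have hwim : w.im = T := by simp [hw]
    -- `|Im(s + w)| = |t + T| ≥ |T| − |t| ≥ 2`, and `|t + T| ≤ (1 + |t|)|T|`
    have him : (s + w).im = s.im + T := by simp [hw]
    have him2 : 2 ≤ |(s + w).im| := by
      rw [him]
      have := abs_sub_abs_le_abs_sub T (-s.im)
      rw [abs_neg, sub_neg_eq_add, add_comm] at this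
      linarith
    have him3 : |(s + w).im| ≤ (1 + |s.im|) * |T| := by
      rw [him]
      calc |s.im + T| ≤ |s.im| + |T| := abs_add_le _ _
        _ ≤ |s.im| * |T| + |T| := by nlinarith [abs_nonneg s.im]
        _ = (1 + |s.im|) * |T| := by ring
    have hrew : (s + w).re = σ + τ := by simp [hw, hσ]
    have hre1 : -3 / 2 ≤ (s + w).re := by rw [hrew]; rw [ha] at hτ; linarith [hτ.1]
    have hre2 : (s + w).re ≤ 2 := by rw [hrew]; rw [hb] at hτ; linarith [hτ.2]
    have hz : ‖zetaL χ (s + w)‖ ≤ C * ((1 + |s.im|) * |T|) ^ 4 := by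
      have h := hgrowth (s + w) hre1 hre2 him2
      have h4 : (s + w).im ^ 4 = |(s + w).im| ^ 4 := (Even.pow_abs (by norm_num : Even 4) _).symm
      rw [h4] at h
      exact h.trans (by gcongr)
    have hxσ : ‖(x : ℂ) ^ w‖ ≤ M := by
      rw [norm_cpow_eq_rpow_re_of_pos hx, hwre]; exact rpow_le_add_of_mem hx hτ.1 hτ.2
    have hKn : ‖hoffKernel w‖ ≤ 1 / |T| ^ 6 := by
      have := norm_hoffKernel_le_of_im (w := w) (by rw [hwim]; exact hTpos); rwa [hwim] at this
    have hTT : |T| ≤ |T| ^ 2 := by nlinarith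
    calc ‖F w‖ = ‖zetaL χ (s + w)‖ * ‖(x : ℂ) ^ w‖ * ‖hoffKernel w‖ := by
          simp only [hFdef]; rw [norm_mul, norm_mul]
      _ ≤ (C * ((1 + |s.im|) * |T|) ^ 4) * M * (1 / |T| ^ 6) := by gcongr
      _ = C * (1 + |s.im|) ^ 4 * M / |T| ^ 2 := by field_simp
      _ ≤ C * (1 + |s.im|) ^ 4 * M / |T| := div_le_div_of_nonneg_left (by positivity) hTpos hTT
      _ ≤ ε := by rw [div_le_iff₀ hTpos]; rw [div_le_iff₀ hε] at hT1; linarith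

/-! ### The right line is the smoothed sum -/

/-- **The Perron side**: on `Re w = 2 − σ` the integral of `G` is
`2π Σ_n (1∗χ)(n) n^{−s} w(n/x)`, a finite sum over `n ≤ x` (`w(u) = P(u)/720` for `u ≤ 1`, `0` beyond)
— the smoothed Perron formula `Hoffstein1980.integral_LSeries_mul_hoffKernel_eq` for
`F = Σ (1∗χ)(n) n^{−z}` (`zetaL_eq_LSeries`). [cite: BellottiPuglisi2023, §2 proof of Lemma 1 p. 5]
[cite: Hoffstein1980SiegelTatuzawa, §2 proof of Lemma 1 p. 169] -/
theorem perron_side (χ : DirichletCharacter ℂ q) {s : ℂ} (hσ1 : s.re ≤ 1) {x : ℝ} (hx : 0 < x)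
    (N : ℕ) (hN : x < N + 1) :
    ∫ y : ℝ, zetaL χ (s + (((2 - s.re : ℝ) : ℂ) + y * I)) * (x : ℂ) ^ (((2 - s.re : ℝ) : ℂ) + y * I) *
        hoffKernel (((2 - s.re : ℝ) : ℂ) + y * I) =
      2 * π * ∑ n ∈ Finset.range (N + 1),
        LSeries.term (fun n ↦ χ.zetaMul n) s n * hoffWeight ((n : ℝ) / x) := by
  have hc : 0 < 2 - s.re := by linarith
  have hre : 1 < (s + ((2 - s.re : ℝ) : ℂ)).re := by
    simp only [add_re, ofReal_re]; linarith
  have hsum := summable_norm_term_zetaMul χ hre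
  have h := integral_LSeries_mul_hoffKernel_eq (fun n ↦ χ.zetaMul n) (s := s) hc hsum hx
  rw [← tsum_term_mul_hoffWeight_eq_sum _ s hx N hN, ← h]
  congr 1
  ext y
  have e : s + (((2 - s.re : ℝ) : ℂ) + y * I) = s + ((2 - s.re : ℝ) : ℂ) + y * I := by ring
  have hre' : 1 < (s + ((2 - s.re : ℝ) : ℂ) + y * I).re := by
    simp only [add_re, ofReal_re, mul_re, I_re, I_im, ofReal_im, mul_zero, zero_mul, sub_zero]
    linarith
  rw [e, zetaL_eq_LSeries χ hre']

/-! ### Removing the weight (the de-smoothing step of Lemma 2, p. 6) -/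

/-- `|P(u) − 1| ≤ 129 u²` for `0 ≤ u ≤ 1`. [folklore] -/
private lemma abs_hoffPoly_sub_one_le {u : ℝ} (h0 : 0 ≤ u) (h1 : u ≤ 1) :
    |hoffPoly u - 1| ≤ 129 * u ^ 2 := by
  have hu3 : u ^ 3 ≤ u ^ 2 := pow_le_pow_of_le_one h0 h1 (by norm_num)
  have hu4 : u ^ 4 ≤ u ^ 2 := pow_le_pow_of_le_one h0 h1 (by norm_num)
  have hu5 : u ^ 5 ≤ u ^ 2 := pow_le_pow_of_le_one h0 h1 (by norm_num)
  have hu6 : u ^ 6 ≤ u ^ 2 := pow_le_pow_of_le_one h0 h1 (by norm_num)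
  rw [hoffPoly, abs_le]
  constructor <;> nlinarith [pow_nonneg h0 3, pow_nonneg h0 4, pow_nonneg h0 5, pow_nonneg h0 6]

omit [NeZero q] in
/-- **De-smoothing**: for a quadratic `χ` (`g = 1∗χ ≥ 0`), `Re s ≤ 2` and `x > 0`,
`‖720 Σ_{n≤x} g(n) n^{−s} w(n/x) − Σ_{n≤x} g(n) n^{−s}‖ ≤ 129 x^{−σ} Σ_{n≤x} g(n)`: termwise
`720 w(n/x) − 1 = P(n/x) − 1`, `|P(u) − 1| ≤ 129u²`, and `n^{−σ}(n/x)² = n^{2−σ} x^{−2} ≤ x^{−σ}`.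
(The source expands `(1 − n/q)²` and bounds `(1/q)Σ g(n)n^{1−s}`, `(1/q²)Σ g(n)n^{2−s}` by
`q^{−σ} Σ_{n≤q} g(n)`, p. 6.) [cite: BellottiPuglisi2023, §2 proof of Lemma 2 p. 6] -/
theorem norm_desmooth_le {χ : DirichletCharacter ℂ q} (hq2 : χ ^ 2 = 1) {s : ℂ} (hσ2 : s.re ≤ 2)
    {x : ℝ} (hx : 0 < x) :
    ‖720 * (∑ n ∈ Finset.range (⌊x⌋₊ + 1),
        LSeries.term (fun n ↦ χ.zetaMul n) s n * hoffWeight ((n : ℝ) / x)) -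
      ∑ n ∈ Finset.Icc 1 ⌊x⌋₊, (RealChar.charDivisorSum χ n : ℂ) * (n : ℂ) ^ (-s)‖ ≤
      129 * x ^ (-s.re) * ∑ n ∈ Finset.Icc 1 ⌊x⌋₊, RealChar.charDivisorSum χ n := by
  -- rewrite the weighted sum over `Icc 1 ⌊x⌋` (the term `n = 0` vanishes)
  have hrange : ∑ n ∈ Finset.range (⌊x⌋₊ + 1),
      LSeries.term (fun n ↦ χ.zetaMul n) s n * hoffWeight ((n : ℝ) / x) =
      ∑ n ∈ Finset.Icc 1 ⌊x⌋₊, LSeries.term (fun n ↦ χ.zetaMul n) s n * hoffWeight ((n : ℝ) / x) := by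
    have hI : Finset.range (⌊x⌋₊ + 1) = insert 0 (Finset.Icc 1 ⌊x⌋₊) := by
      ext n; simp only [Finset.mem_range, Finset.mem_insert, Finset.mem_Icc]; omega
    rw [hI, Finset.sum_insert (by simp)]
    simp
  rw [hrange, Finset.mul_sum, ← Finset.sum_sub_distrib]
  -- termwise
  have hterm : ∀ n ∈ Finset.Icc 1 ⌊x⌋₊,
      ‖720 * (LSeries.term (fun n ↦ χ.zetaMul n) s n * hoffWeight ((n : ℝ) / x)) -
          (RealChar.charDivisorSum χ n : ℂ) * (n : ℂ) ^ (-s)‖ ≤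
        129 * x ^ (-s.re) * RealChar.charDivisorSum χ n := by
    intro n hn
    rw [Finset.mem_Icc] at hn
    have hn0 : n ≠ 0 := by omega
    have hnpos : (0 : ℝ) < n := by exact_mod_cast Nat.pos_of_ne_zero hn0
    have hnx : (n : ℝ) ≤ x := (Nat.cast_le.2 hn.2).trans (Nat.floor_le hx.le)
    set u : ℝ := (n : ℝ) / x with hu
    have hu0 : 0 ≤ u := by positivity
    have hu1 : u ≤ 1 := by rw [hu, div_le_one hx]; exact hnx
    have hg0 : 0 ≤ RealChar.charDivisorSum χ n := RealChar.charDivisorSum_nonneg χ hq2 n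
    rw [LSeries.term_def₀ (by simp) s n, ← RealChar.ofReal_charDivisorSum χ hq2 n,
      hoffWeight_of_le_one hu1]
    have e : 720 * (((RealChar.charDivisorSum χ n : ℝ) : ℂ) * (n : ℂ) ^ (-s) *
        (((hoffPoly u / 720 : ℝ)) : ℂ)) - ((RealChar.charDivisorSum χ n : ℝ) : ℂ) * (n : ℂ) ^ (-s) =
        ((RealChar.charDivisorSum χ n : ℝ) : ℂ) * (n : ℂ) ^ (-s) * (((hoffPoly u - 1 : ℝ)) : ℂ) := by
      push_cast; ring
    rw [e, norm_mul, norm_mul, Complex.norm_real, Complex.norm_real, Real.norm_eq_abs,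
      Real.norm_eq_abs, abs_of_nonneg hg0, Complex.norm_natCast_cpow_of_pos (Nat.pos_of_ne_zero hn0),
      neg_re]
    have hP := abs_hoffPoly_sub_one_le hu0 hu1
    -- `n^{-σ} u² ≤ x^{-σ}`
    have hkey : (n : ℝ) ^ (-s.re) * u ^ 2 ≤ x ^ (-s.re) := by
      have h1 : (n : ℝ) ^ (-s.re) * u ^ 2 = (n : ℝ) ^ (2 - s.re) * x ^ (-(2 : ℝ)) := by
        rw [hu, div_pow, show (2 - s.re) = -s.re + 2 by ring, Real.rpow_add hnpos,
          Real.rpow_neg hx.le, Real.rpow_two, Real.rpow_two]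
        field_simp
      rw [h1]
      have h2 : (n : ℝ) ^ (2 - s.re) ≤ x ^ (2 - s.re) :=
        Real.rpow_le_rpow hnpos.le hnx (by linarith)
      calc (n : ℝ) ^ (2 - s.re) * x ^ (-(2 : ℝ)) ≤ x ^ (2 - s.re) * x ^ (-(2 : ℝ)) :=
            mul_le_mul_of_nonneg_right h2 (Real.rpow_nonneg hx.le _)
        _ = x ^ (-s.re) := by rw [← Real.rpow_add hx]; ring_nf
    calc RealChar.charDivisorSum χ n * (n : ℝ) ^ (-s.re) * |hoffPoly u - 1|
        ≤ RealChar.charDivisorSum χ n * (n : ℝ) ^ (-s.re) * (129 * u ^ 2) := by gcongr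
      _ = 129 * ((n : ℝ) ^ (-s.re) * u ^ 2) * RealChar.charDivisorSum χ n := by ring
      _ ≤ 129 * x ^ (-s.re) * RealChar.charDivisorSum χ n := by gcongr
  calc ‖∑ n ∈ Finset.Icc 1 ⌊x⌋₊, (720 * (LSeries.term (fun n ↦ χ.zetaMul n) s n * hoffWeight ((n : ℝ) / x)) -
          (RealChar.charDivisorSum χ n : ℂ) * (n : ℂ) ^ (-s))‖
      ≤ ∑ n ∈ Finset.Icc 1 ⌊x⌋₊, ‖720 * (LSeries.term (fun n ↦ χ.zetaMul n) s n * hoffWeight ((n : ℝ) / x)) -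
          (RealChar.charDivisorSum χ n : ℂ) * (n : ℂ) ^ (-s)‖ := norm_sum_le _ _
    _ ≤ ∑ n ∈ Finset.Icc 1 ⌊x⌋₊, 129 * x ^ (-s.re) * RealChar.charDivisorSum χ n := Finset.sum_le_sum hterm
    _ = 129 * x ^ (-s.re) * ∑ n ∈ Finset.Icc 1 ⌊x⌋₊, RealChar.charDivisorSum χ n := by
        rw [Finset.mul_sum]

/-! ### The approximate formula on `½ ≤ σ ≤ 1` (Lemma 1 + the de-smoothing of Lemma 2) -/

/-- **Bellotti–Puglisi's Lemmas 1–2, uniform core.** There is an absolute constant `C` such that for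
every primitive quadratic `χ` modulo `q ≥ 3`, every `s = σ + it` with `½ ≤ σ ≤ 1`, `s ≠ 1`, and every
real `x ≥ 1`, with `g = 1 ∗ χ` and `F = ζ · L(·,χ)`:
`‖Σ_{n≤x} g(n) n^{−s} − ζ(s)L(s,χ)‖ ≤ 720 ‖L(1,χ)‖ x^{1−σ} ‖K(1−s)‖ +
C √q (2 log q + 1)(1 + |t|)³ x^{−σ} + 129 x^{−σ} Σ_{n≤x} g(n)`
— the three terms being the residue `x^{1−s}L(1,χ)K(1−s)` of the pole of `ζ`, the shifted integral on
`Re(s+w) = 0`, and the removed weights. (The print, with the Cesàro kernel, `x = q` and `σ ≥ ½ + ℓ`: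
`Σ_{n≤q} g(n)n^{−s} = L(s,χ)ζ(s) + 2q^{1−s}L(1,χ)/((1−s)(2−s)(3−s)) + O(|s|log²(1+|s|) q^{−ℓ}log q)
+ (2/q)Σ g(n)n^{1−s} − (1/q²)Σ g(n)n^{2−s}`, p. 6.)
[cite: BellottiPuglisi2023, §2 Lemma 1 p. 5, proof of Lemma 2 p. 6] -/
theorem approx_formula :
    ∃ C : ℝ, 0 < C ∧ ∀ {q : ℕ} [NeZero q], 3 ≤ q → ∀ {χ : DirichletCharacter ℂ q}, χ.IsPrimitive →
      χ ^ 2 = 1 → ∀ {s : ℂ}, 1 / 2 ≤ s.re → s.re ≤ 1 → s ≠ 1 → ∀ {x : ℝ}, 1 ≤ x →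
        ‖(∑ n ∈ Finset.Icc 1 ⌊x⌋₊, (RealChar.charDivisorSum χ n : ℂ) * (n : ℂ) ^ (-s)) -
            riemannZeta s * χ.LFunction s‖ ≤
          720 * ‖χ.LFunction 1‖ * x ^ (1 - s.re) * ‖hoffKernel (1 - s)‖ +
            C * (Real.sqrt q * (2 * Real.log q + 1)) * (1 + |s.im|) ^ 3 * x ^ (-s.re) +
            129 * x ^ (-s.re) * ∑ n ∈ Finset.Icc 1 ⌊x⌋₊, RealChar.charDivisorSum χ n := by
  obtain ⟨C, hC, hline⟩ := exists_integral_line_le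
  refine ⟨360 / π * C, by positivity, ?_⟩
  intro q _ hq χ hχ hq2 s hσ0 hσ1 hs1 x hx1
  have hx : 0 < x := by linarith
  have hσ2 : s.re ≤ 2 := by linarith
  set Sg : ℂ := ∑ n ∈ Finset.Icc 1 ⌊x⌋₊, (RealChar.charDivisorSum χ n : ℂ) * (n : ℂ) ^ (-s) with hSg
  set W : ℂ := ∑ n ∈ Finset.range (⌊x⌋₊ + 1),
    LSeries.term (fun n ↦ χ.zetaMul n) s n * hoffWeight ((n : ℝ) / x) with hW
  set IR : ℂ := ∫ y : ℝ, zetaL χ (s + (((2 - s.re : ℝ) : ℂ) + y * I)) *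
    (x : ℂ) ^ (((2 - s.re : ℝ) : ℂ) + y * I) * hoffKernel (((2 - s.re : ℝ) : ℂ) + y * I) with hIR
  set IL : ℂ := ∫ y : ℝ, zetaL χ (s + (((-s.re : ℝ) : ℂ) + y * I)) *
    (x : ℂ) ^ (((-s.re : ℝ) : ℂ) + y * I) * hoffKernel (((-s.re : ℝ) : ℂ) + y * I) with hILdef
  set Res : ℂ := χ.LFunction 1 * (x : ℂ) ^ (1 - s) * hoffKernel (1 - s) with hRes
  -- the three identities
  have hP : IR = 2 * π * W := perron_side χ hσ1 hx ⌊x⌋₊ (Nat.lt_floor_add_one x)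
  have hCI : IR - IL = 2 * π * (Res + zetaL χ s / 720) := contour_identity hq hχ hσ0 hσ1 hs1 hx
  have hD := norm_desmooth_le hq2 hσ2 hx
  rw [← hW, ← hSg] at hD
  have hπ0 : (π : ℂ) ≠ 0 := ofReal_ne_zero.2 Real.pi_pos.ne'
  -- `Sg − F(s) = (Sg − 720 W) + 720 Res + (360/π) IL`
  have hkey : Sg - riemannZeta s * χ.LFunction s =
      (Sg - 720 * W) + 720 * Res + (360 / π : ℂ) * IL := by
    have hW' : (720 : ℂ) * W = 720 * Res + zetaL χ s + (360 / π : ℂ) * IL := by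
      have h1 : 2 * (π : ℂ) * W = 2 * π * (Res + zetaL χ s / 720) + IL := by
        rw [← hP, ← hCI]; ring
      have h2 : (720 : ℂ) * W = (360 / π : ℂ) * (2 * π * W) := by field_simp; ring
      rw [h2, h1]; field_simp; ring
    rw [zetaL] at hW'
    linear_combination hW'
  rw [hkey]
  have hILb := hline hq hχ hσ0 hσ1 hx
  rw [← hILdef] at hILb
  have hn360 : ‖(360 / π : ℂ)‖ = 360 / π := by
    rw [show (360 / π : ℂ) = ((360 / π : ℝ) : ℂ) by push_cast; rfl, Complex.norm_real,
      Real.norm_eq_abs, abs_of_pos (by positivity)]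
  have hResn : ‖(720 : ℂ) * Res‖ = 720 * ‖χ.LFunction 1‖ * x ^ (1 - s.re) * ‖hoffKernel (1 - s)‖ := by
    rw [norm_mul, hRes, norm_mul, norm_mul, norm_cpow_eq_rpow_re_of_pos hx, sub_re, one_re]
    simp
    ring
  calc ‖Sg - 720 * W + 720 * Res + (360 / π : ℂ) * IL‖
      ≤ ‖Sg - 720 * W‖ + ‖(720 : ℂ) * Res‖ + ‖(360 / π : ℂ) * IL‖ := norm_add₃_le
    _ ≤ 129 * x ^ (-s.re) * (∑ n ∈ Finset.Icc 1 ⌊x⌋₊, RealChar.charDivisorSum χ n) +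
          720 * ‖χ.LFunction 1‖ * x ^ (1 - s.re) * ‖hoffKernel (1 - s)‖ +
          360 / π * (C * (Real.sqrt q * (2 * Real.log q + 1)) * (1 + |s.im|) ^ 3 * x ^ (-s.re)) := by
        refine add_le_add (add_le_add ?_ hResn.le) ?_
        · rw [norm_sub_rev]; exact hD
        · rw [norm_mul, hn360]; exact mul_le_mul_of_nonneg_left hILb (by positivity)
    _ = _ := by ring

end Literature.NumberTheory.LFunctions.BPPerron

end
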